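import Mathlib
import Summits.CriticalPhenomena.CardyFormulaZ2.Theorems.CardyWhiteToColouredDriftBoundPlackettStein
import Summits.CriticalPhenomena.CardyFormulaZ2.Theorems.CardyWhiteToColouredDriftBoundPlackettEnvelope
import Summits.CriticalPhenomena.CardyFormulaZ2.Theorems.CardyWhiteToColouredDriftBoundPlackettDeriv

/-!
# Plackett/Piterbarg drift identity for the noise heat flow, part 4: Gaussian integration by parts
# of the drift term

Helper file for crux item `DriftBound` (stmt-CriticalPhenomena-4596) of route `CardyWhiteToColoured`
(`CardyFormulaZ2`), line `registered` (`Cruxes/DriftBound/Lines/birth.lean`, lead c3), sub-goal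
`pl_integral_fderiv_linGauss` of the exact drift identity: the Gaussian-integration-by-parts half of
the Plackett/Piterbarg formula.

Setting: `I` finite, `ι` countable, `γ∞ = ⨂_e N(0,1)` (Mathlib `Measure.infinitePi`) on `ι → ℝ`,
`Ψ ∈ C²_b(ℝ^I)`, and two `ℓ¹`-linear Gaussian series `X_i(ξ) = ∑' e, g i e ξ_e` (the field) and
`V_i(ξ) = ∑' e, h i e ξ_e` (its velocity along the line), with coefficients dominated by one summable
envelope `u`: `|g i e|, |h i e| ≤ u e`. Then
`∫ DΨ(X)[V] dγ∞ = ∑_{i,j} (∑' e, h i e g j e) ∫ ∂_j ∂_i Ψ(X) dγ∞`,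
where `∂_i Ψ(y) = DΨ(y)[e_i]` and `∂_j ∂_i Ψ(x) = D(∂_i Ψ)(x)[e_j]`:

* expand `DΨ(X)[V] = ∑_i V_i ∂_i Ψ(X)` and exchange `∫` with the series `V_i = ∑' e, h i e ξ_e`
  (dominated convergence against the integrable envelope `∑' e, |u_e| |ξ_e|`, `pl_integrable_envelope`);
* Gaussian integration by parts in the single coordinate `ξ_e` (`pl_stein_infinitePi'`): along the
  section `t ↦ update ξ e t` the field moves on the affine line `X + (t - ξ_e) g_{·e}`, so
  `∫ ξ_e ∂_i Ψ(X) dγ∞ = ∫ D(∂_i Ψ)(X)[g_{·e}] dγ∞ = ∑_j g j e ∫ ∂_j ∂_i Ψ(X) dγ∞`;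
* resum over `e` (the double coefficient series `∑' e, h i e g j e` converges absolutely).

References: D. Beliaev, S. Muirhead, A. Rivera, Ann. Probab. 48 (2020), Lemma 2.22 (Piterbarg's
formula); R. L. Plackett, Biometrika 41 (1954) (the Gaussian interpolation identity).
-/

noncomputable section

namespace Summit.CriticalPhenomena.CardyFormulaZ2.Cruxes.DriftBound.Birth

open MeasureTheory ProbabilityTheory Filter Topology Set
open scoped ENNReal NNReal

variable {ι : Type*} {I : Type*} [Fintype I] [DecidableEq I]

/-! ### Coordinates and second derivatives on `ℝ^I` -/

/-- A linear functional on `ℝ^I` in coordinates: `L v = ∑ i, v i * L (e_i)`. -/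
theorem pb_clm_apply_eq_sum (L : (I → ℝ) →L[ℝ] ℝ) (v : I → ℝ) :
    L v = ∑ i, v i * L (Pi.single i 1) := by
  conv_lhs => rw [← Finset.univ_sum_single v]
  rw [map_sum]
  refine Finset.sum_congr rfl fun i _ => ?_
  rw [← smul_eq_mul, ← map_smul, ← Pi.single_smul', smul_eq_mul, mul_one]

/-- `|L (e_i)| ≤ ‖L‖` for a linear functional `L` on `ℝ^I` (sup norm, `‖e_i‖ = 1`). -/
theorem pb_abs_apply_single_le {L : (I → ℝ) →L[ℝ] ℝ} {M : ℝ} (hL : ‖L‖ ≤ M) (i : I) :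
    |L (Pi.single i 1)| ≤ M := by
  rw [← Real.norm_eq_abs]
  calc ‖L (Pi.single i 1)‖ ≤ M * ‖(Pi.single i (1 : ℝ) : I → ℝ)‖ := L.le_of_opNorm_le hL _
    _ = M := by rw [Pi.norm_single, norm_one, mul_one]

/-- The derivative of the partial derivative `∂_i Ψ : y ↦ DΨ(y)[e_i]` of `Ψ ∈ C²` is
`w ↦ D²Ψ(y)[w][e_i]`. -/
theorem pb_fderiv_partial {Ψ : (I → ℝ) → ℝ} (hΨ : ContDiff ℝ 2 Ψ) (i : I) (y w : I → ℝ) :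
    fderiv ℝ (fun y => fderiv ℝ Ψ y (Pi.single i 1)) y w =
      fderiv ℝ (fderiv ℝ Ψ) y w (Pi.single i 1) := by
  have h2 : DifferentiableAt ℝ (fderiv ℝ Ψ) y :=
    (hΨ.fderiv_right (m := 1) (by norm_num)).differentiable one_ne_zero y
  rw [fderiv_clm_apply h2 (differentiableAt_const _)]
  simp

/-- `‖D(∂_i Ψ)(y)‖ ≤ M` whenever `‖D²Ψ‖ ≤ M`. -/
theorem pb_norm_fderiv_partial_le {Ψ : (I → ℝ) → ℝ} (hΨ : ContDiff ℝ 2 Ψ) {M : ℝ}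
    (hM : ∀ x, ‖fderiv ℝ (fderiv ℝ Ψ) x‖ ≤ M) (i : I) (y : I → ℝ) :
    ‖fderiv ℝ (fun y => fderiv ℝ Ψ y (Pi.single i 1)) y‖ ≤ M := by
  refine ContinuousLinearMap.opNorm_le_bound _
    ((norm_nonneg (fderiv ℝ (fderiv ℝ Ψ) y)).trans (hM y)) fun w => ?_
  rw [pb_fderiv_partial hΨ]
  calc ‖fderiv ℝ (fderiv ℝ Ψ) y w (Pi.single i 1)‖
      ≤ ‖fderiv ℝ (fderiv ℝ Ψ) y w‖ * ‖(Pi.single i (1 : ℝ) : I → ℝ)‖ :=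
        (fderiv ℝ (fderiv ℝ Ψ) y w).le_opNorm _
    _ = ‖fderiv ℝ (fderiv ℝ Ψ) y w‖ := by rw [Pi.norm_single, norm_one, mul_one]
    _ ≤ ‖fderiv ℝ (fderiv ℝ Ψ) y‖ * ‖w‖ := (fderiv ℝ (fderiv ℝ Ψ) y).le_opNorm w
    _ ≤ M * ‖w‖ := mul_le_mul_of_nonneg_right (hM y) (norm_nonneg _)

/-! ### Series against the noise -/

/-- Two coefficient families dominated by a summable envelope `v ≥ 0` have a summable product. -/
theorem pb_summable_mul {v : ι → ℝ} (hv : Summable v) (hv0 : ∀ e, 0 ≤ v e) {a b : ι → ℝ}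
    (ha : ∀ e, |a e| ≤ v e) (hb : ∀ e, |b e| ≤ v e) : Summable fun e => a e * b e := by
  refine (hv.mul_left (∑' e, v e)).of_norm_bounded fun e => ?_
  rw [Real.norm_eq_abs, abs_mul]
  exact mul_le_mul ((ha e).trans (hv.le_tsum e fun e' _ => hv0 e')) (hb e) (abs_nonneg _)
    (tsum_nonneg hv0)

variable [Countable ι]

/-- A dominated linear series times a bounded measurable factor is integrable against `γ∞`:
`ξ ↦ (∑' e, c_e ξ_e) H(ξ) ∈ L¹(γ∞)` when `|c_e| ≤ v_e`, `∑ v_e < ∞`, `|H| ≤ C`. -/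
theorem pb_integrable_tsum_mul {v : ι → ℝ} (hv : Summable v) (hv0 : ∀ e, 0 ≤ v e) {c : ι → ℝ}
    (hc : ∀ e, |c e| ≤ v e) {H : (ι → ℝ) → ℝ} (hHm : Measurable H) {C : ℝ} (hHC : ∀ ξ, |H ξ| ≤ C) :
    Integrable (fun ξ : ι → ℝ => (∑' e, c e * ξ e) * H ξ)
      (Measure.infinitePi fun _ : ι => gaussianReal 0 1) := by
  refine ((pl_integrable_envelope hv hv0).const_mul C).mono'
    (((Measurable.tsum fun e => measurable_const.mul (measurable_pi_apply e)).mul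
      hHm).aestronglyMeasurable) ?_
  filter_upwards [pl_ae_summable_envelope hv hv0] with ξ hξ
  rw [norm_mul]
  calc ‖∑' e, c e * ξ e‖ * ‖H ξ‖ ≤ (∑' e, v e * |ξ e|) * C :=
        mul_le_mul (pd_norm_tsum_le hc hξ).2 ((Real.norm_eq_abs _).le.trans (hHC ξ)) (norm_nonneg _)
          (tsum_nonneg fun e => mul_nonneg (hv0 e) (abs_nonneg _))
    _ = C * ∑' e, v e * |ξ e| := mul_comm _ _

/-- **Exchange of `∫ dγ∞` and a dominated linear series**:
`∫ (∑' e, c_e ξ_e) H(ξ) dγ∞ = ∑' e, c_e ∫ ξ_e H(ξ) dγ∞` for `|c_e| ≤ v_e` (`∑ v_e < ∞`) and `H`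
measurable with `|H| ≤ C` (dominated convergence for series, the dominating function being
`C ∑' e, v_e |ξ_e|`, integrable by `pl_integrable_envelope`). -/
theorem pb_integral_tsum_mul {v : ι → ℝ} (hv : Summable v) (hv0 : ∀ e, 0 ≤ v e) {c : ι → ℝ}
    (hc : ∀ e, |c e| ≤ v e) {H : (ι → ℝ) → ℝ} (hHm : Measurable H) {C : ℝ} (hHC : ∀ ξ, |H ξ| ≤ C) :
    ∫ ξ, (∑' e, c e * ξ e) * H ξ ∂Measure.infinitePi (fun _ : ι => gaussianReal 0 1) =
      ∑' e, c e * ∫ ξ, ξ e * H ξ ∂Measure.infinitePi (fun _ : ι => gaussianReal 0 1) := by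
  have hsum := hasSum_integral_of_dominated_convergence
    (μ := Measure.infinitePi fun _ : ι => gaussianReal 0 1)
    (F := fun e ξ => c e * ξ e * H ξ) (f := fun ξ => (∑' e, c e * ξ e) * H ξ)
    (fun e ξ => C * (v e * |ξ e|)) (fun e => ?_) (fun e => ae_of_all _ fun ξ => ?_) ?_ ?_ ?_
  · rw [← hsum.tsum_eq]
    refine tsum_congr fun e => ?_
    rw [← integral_const_mul]
    exact integral_congr_ae (ae_of_all _ fun ξ => mul_assoc _ _ _)
  · exact ((measurable_const.mul (measurable_pi_apply e)).mul hHm).aestronglyMeasurable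
  · rw [Real.norm_eq_abs, abs_mul, abs_mul]
    calc |c e| * |ξ e| * |H ξ| ≤ v e * |ξ e| * C :=
          mul_le_mul (mul_le_mul_of_nonneg_right (hc e) (abs_nonneg _)) (hHC ξ) (abs_nonneg _)
            (mul_nonneg (hv0 e) (abs_nonneg _))
      _ = C * (v e * |ξ e|) := by ring
  · filter_upwards [pl_ae_summable_envelope hv hv0] with ξ hξ
    exact hξ.mul_left C
  · simp_rw [tsum_mul_left]
    exact (pl_integrable_envelope hv hv0).const_mul C
  · filter_upwards [pl_ae_summable_envelope hv hv0] with ξ hξ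
    exact (pd_norm_tsum_le hc hξ).1.hasSum.mul_right (H ξ)

variable [DecidableEq ι]

/-- **Gaussian integration by parts against a linear series.** For `Φ ∈ C¹_b(ℝ^I)`, a dominated
`ℓ¹`-linear series `X_i(ξ) = ∑' e', g i e' ξ_{e'}` and a coordinate `e`,
`∫ ξ_e Φ(X ξ) dγ∞ = ∑_j g j e ∫ ∂_j Φ(X ξ) dγ∞`: along the section `t ↦ update ξ e t` the series
moves on the affine line `X ξ + (t - ξ_e) g_{·e}` (for a.e. `ξ`, those with finite envelope), so
`pl_stein_infinitePi'` applies with derivative `DΦ(X ξ)[g_{·e}] = ∑_j g j e ∂_j Φ(X ξ)`. -/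
theorem pb_stein_linSeries {g : I → ι → ℝ} {v : ι → ℝ} (hv : Summable v) (hv0 : ∀ e, 0 ≤ v e)
    (hg : ∀ i e, |g i e| ≤ v e) {Φ : (I → ℝ) → ℝ} (hΦ : ContDiff ℝ 1 Φ) {C : ℝ}
    (hΦC : ∀ x, |Φ x| ≤ C) (hΦ'C : ∀ x, ‖fderiv ℝ Φ x‖ ≤ C) (e : ι) :
    ∫ ξ, ξ e * Φ (fun i => ∑' e', g i e' * ξ e') ∂Measure.infinitePi (fun _ : ι => gaussianReal 0 1) =
      ∑ j, g j e * ∫ ξ, fderiv ℝ Φ (fun i => ∑' e', g i e' * ξ e') (Pi.single j 1)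
        ∂Measure.infinitePi (fun _ : ι => gaussianReal 0 1) := by
  have hΦd : Differentiable ℝ Φ := hΦ.differentiable one_ne_zero
  have hXm : Measurable fun ξ : ι → ℝ => fun i : I => ∑' e', g i e' * ξ e' := pd_measurable_linSeries g
  have hHm : Measurable fun ξ : ι → ℝ => Φ (fun i : I => ∑' e', g i e' * ξ e') :=
    hΦ.continuous.measurable.comp hXm
  have hDm : ∀ w : I → ℝ, Measurable fun ξ : ι → ℝ => fderiv ℝ Φ (fun i : I => ∑' e', g i e' * ξ e') w :=
    fun w => ((hΦ.continuous_fderiv one_ne_zero).clm_apply continuous_const).measurable.comp hXm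
  have hDb : ∀ (w : I → ℝ) (ξ : ι → ℝ), |fderiv ℝ Φ (fun i : I => ∑' e', g i e' * ξ e') w| ≤ C * ‖w‖ :=
    fun w ξ => by rw [← Real.norm_eq_abs]; exact (fderiv ℝ Φ _).le_of_opNorm_le (hΦ'C _) w
  -- Stein's lemma in the coordinate `e`, with `D = DΦ(X ξ)[g_{·e}]`
  have hstein : ∫ ξ, ξ e * Φ (fun i => ∑' e', g i e' * ξ e')
      ∂Measure.infinitePi (fun _ : ι => gaussianReal 0 1) =
      ∫ ξ, fderiv ℝ Φ (fun i => ∑' e', g i e' * ξ e') (fun i => g i e)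
        ∂Measure.infinitePi (fun _ : ι => gaussianReal 0 1) := by
    refine pl_stein_infinitePi' e hHm (hDm _) (C := max C (C * ‖fun i => g i e‖))
      (fun ξ => (hΦC _).trans (le_max_left _ _)) (fun ξ => (hDb _ _).trans (le_max_right _ _)) ?_
    filter_upwards [pl_ae_summable_envelope hv hv0] with ζ hζ
    intro t
    -- the one-coordinate section of the series is an affine line
    have hpath : ∀ s : ℝ, (fun i => ∑' e', g i e' * Function.update ζ e s e') =
        (fun i => ∑' e', g i e' * ζ e') + (s - ζ e) • fun i => g i e := by
      intro s
      funext i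
      simp only [Pi.add_apply, Pi.smul_apply, smul_eq_mul]
      have h1 : (fun e' => g i e' * Function.update ζ e s e') =
          fun e' => g i e' * ζ e' + (Pi.single e ((s - ζ e) * g i e) : ι → ℝ) e' := by
        funext e'
        rcases eq_or_ne e' e with rfl | hne
        · rw [Function.update_self, Pi.single_eq_same]; ring
        · rw [Function.update_of_ne hne, Pi.single_eq_of_ne hne, add_zero]
      rw [h1, (pd_norm_tsum_le (hg i) hζ).1.tsum_add (hasSum_pi_single e _).summable, tsum_pi_single]
    have hline : HasDerivAt (fun s : ℝ => (fun i => ∑' e', g i e' * ζ e') + (s - ζ e) • fun i => g i e)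
        (fun i => g i e) t :=
      ((((hasDerivAt_id' t).sub_const (ζ e)).smul_const fun i => g i e).const_add
        fun i => ∑' e', g i e' * ζ e').congr_deriv (one_smul _ _)
    have hcomp := (hΦd _).hasFDerivAt.comp_hasDerivAt t hline
    exact (hcomp.congr_deriv (congrArg (fun x => fderiv ℝ Φ x fun i => g i e) (hpath t).symm))
      |>.congr_of_eventuallyEq (Eventually.of_forall fun s => congrArg Φ (hpath s))
  rw [hstein]
  have hexp : (fun ξ : ι → ℝ => fderiv ℝ Φ (fun i => ∑' e', g i e' * ξ e') fun i => g i e) =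
      fun ξ => ∑ j, g j e * fderiv ℝ Φ (fun i => ∑' e', g i e' * ξ e') (Pi.single j 1) :=
    funext fun ξ => pb_clm_apply_eq_sum _ _
  rw [hexp, integral_finsetSum _ fun j _ =>
    (pl_integrable_of_bounded_infinitePi (hDm _) (hDb (Pi.single j 1))).const_mul (g j e)]
  exact Finset.sum_congr rfl fun j _ => integral_const_mul _ _

/-- **Gaussian integration by parts of the drift term (registered form).** For `Ψ ∈ C²_b(ℝ^I)`
(`I` finite), i.i.d. standard Gaussians `(ξ_e)_{e ∈ ι}` (`ι` countable, law
`γ∞ = Measure.infinitePi (fun _ => gaussianReal 0 1)`), and two `ℓ¹`-linear series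
`X_i = ∑' e, g i e ξ_e`, `V_i = ∑' e, h i e ξ_e` dominated by one summable envelope `u`,
`∫ DΨ(X)[V] dγ∞ = ∑_i ∑_j (∑' e, h i e g j e) ∫ ∂_j ∂_i Ψ(X) dγ∞` with
`∂_i Ψ(y) = DΨ(y)[e_i]`, `∂_j ∂_i Ψ(x) = D(∂_i Ψ)(x)[e_j]` (Beliaev–Muirhead–Rivera 2020, Lemma 2.22,
integration-by-parts step; Plackett 1954). Proof: `DΨ(X)[V] = ∑_i V_i ∂_i Ψ(X)`
(`pb_clm_apply_eq_sum`); exchange `∫` and `∑' e` (`pb_integral_tsum_mul`); Stein in the coordinate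
`ξ_e` for `∂_i Ψ ∈ C¹_b` (`pb_stein_linSeries`); resum. -/
theorem pl_integral_fderiv_linGauss : ∀ {ι : Type} [DecidableEq ι] [Countable ι] {I : Type} [Fintype I] [DecidableEq I] (g h : I → ι → ℝ) (u : ι → ℝ), Summable u → (∀ (i : I) (e : ι), |g i e| ≤ u e) → (∀ (i : I) (e : ι), |h i e| ≤ u e) → ∀ (Ψ : (I → ℝ) → ℝ) (M : ℝ), ContDiff ℝ 2 Ψ → (∀ x : I → ℝ, ‖fderiv ℝ Ψ x‖ ≤ M) → (∀ x : I → ℝ, ‖fderiv ℝ (fderiv ℝ Ψ) x‖ ≤ M) → MeasureTheory.integral (MeasureTheory.Measure.infinitePi (fun _ : ι => ProbabilityTheory.gaussianReal 0 1)) (fun ξ : ι → ℝ => fderiv ℝ Ψ (fun i : I => ∑' e : ι, g i e * ξ e) (fun i : I => ∑' e : ι, h i e * ξ e)) = ∑ i : I, ∑ j : I, (∑' e : ι, h i e * g j e) * MeasureTheory.integral (MeasureTheory.Measure.infinitePi (fun _ : ι => ProbabilityTheory.gaussianReal 0 1)) (fun ξ : ι → ℝ => fderiv ℝ (fun y : I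 → ℝ => fderiv ℝ Ψ y (Pi.single i 1)) (fun i' : I => ∑' e : ι, g i' e * ξ e) (Pi.single j 1)) := by
  intro ι _ _ I _ _ g h u hu hgu hhu Ψ M hΨ hM1 hM2
  -- the nonnegative envelope `v = |u|`
  have hv0 : ∀ e, 0 ≤ |u e| := fun e => abs_nonneg _
  have hvs : Summable fun e => |u e| := hu.abs
  have hgv : ∀ i e, |g i e| ≤ |u e| := fun i e => (hgu i e).trans (le_abs_self _)
  have hhv : ∀ i e, |h i e| ≤ |u e| := fun i e => (hhu i e).trans (le_abs_self _)
  have hXm : Measurable fun ξ : ι → ℝ => fun i : I => ∑' e, g i e * ξ e := pd_measurable_linSeries g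
  -- the partial derivatives `∂_i Ψ ∈ C¹_b`
  have hD1 : ∀ i : I, ContDiff ℝ 1 fun y => fderiv ℝ Ψ y (Pi.single i 1) := fun i =>
    (hΨ.fderiv_right (m := 1) (by norm_num)).clm_apply contDiff_const
  have hDb : ∀ (i : I) (y : I → ℝ), |fderiv ℝ Ψ y (Pi.single i 1)| ≤ M := fun i y =>
    pb_abs_apply_single_le (hM1 y) i
  have hDm : ∀ i : I, Measurable fun ξ : ι → ℝ =>
      fderiv ℝ Ψ (fun i' : I => ∑' e, g i' e * ξ e) (Pi.single i 1) :=
    fun i => (hD1 i).continuous.measurable.comp hXm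
  -- Step 1: `DΨ(X)[V] = ∑_i V_i ∂_i Ψ(X)`
  have h1 : ∀ ξ : ι → ℝ, fderiv ℝ Ψ (fun i : I => ∑' e, g i e * ξ e) (fun i : I => ∑' e, h i e * ξ e) =
      ∑ i, (∑' e, h i e * ξ e) * fderiv ℝ Ψ (fun i' : I => ∑' e, g i' e * ξ e) (Pi.single i 1) :=
    fun ξ => pb_clm_apply_eq_sum _ _
  simp_rw [h1]
  rw [integral_finsetSum _ fun i _ => pb_integrable_tsum_mul hvs hv0 (hhv i) (hDm i) fun ξ => hDb i _]
  refine Finset.sum_congr rfl fun i _ => ?_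
  -- Step 2: exchange `∫` and `∑' e`; Step 3: Stein in the coordinate `e`
  rw [pb_integral_tsum_mul hvs hv0 (hhv i) (hDm i) fun ξ => hDb i _]
  simp_rw [pb_stein_linSeries hvs hv0 hgv (hD1 i) (hDb i) (pb_norm_fderiv_partial_le hΨ hM2 i),
    Finset.mul_sum]
  -- Step 4: resum over `e`
  have hs : ∀ j : I, Summable fun e => h i e * (g j e *
      ∫ ξ, fderiv ℝ (fun y : I → ℝ => fderiv ℝ Ψ y (Pi.single i 1)) (fun i' : I => ∑' e, g i' e * ξ e)
        (Pi.single j 1) ∂Measure.infinitePi (fun _ : ι => gaussianReal 0 1)) := fun j => by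
    simp_rw [← mul_assoc]
    exact (pb_summable_mul hvs hv0 (hhv i) (hgv j)).mul_right _
  rw [Summable.tsum_finsetSum fun j _ => hs j]
  refine Finset.sum_congr rfl fun j _ => ?_
  rw [← tsum_mul_right]
  exact tsum_congr fun e => (mul_assoc _ _ _).symm

end Summit.CriticalPhenomena.CardyFormulaZ2.Cruxes.DriftBound.Birth

end
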